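import Summits.BirchSwinnertonDyer.BirchSwinnertonDyer.Theorems.ThetaPartnerAtTwoSignedKatoUpToAtTwoLocalTowerGeneration
import Summits.BirchSwinnertonDyer.BirchSwinnertonDyer.Theorems.ThetaPartnerAtTwoSignedKatoUpToAtTwoLocalTwoTorsion
import HarnessLib

/-!
# Route `ThetaPartnerAtTwo` (TP2), crux K3 `SignedKatoDivisibilityUpToAtTwo` (item stmt-BirchSwinnertonDyer-20308),
# line `colemanrat` v3 — THE LOCAL THEORY AT `p = 2`, file 5: Kobayashi §8.4 along `ℚ₂(ζ_{2^m})` with NO torsion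
# hypothesis — Prop. 8.7 (no `2`-power torsion in `E(ℚ₂(ζ_{2^m}))`), the generation step Prop. 8.11 ⇒ 8.12 ii)
# and the trace relations of Lemma 8.9, all at `p = 2`

HONEST FRAMING (cell `bsd-wall`, lead `bsd-wall-tp2-p2x` g2): THEOREMS ONLY — no definition, no named fact, no
instance, no `sorry`; local formal-group theory at `p = 2`; nothing about any Selmer group is asserted; closes no
item; BSD is NOT proved by any of this.

## What is proved (`M/ℤ₂` with elliptic generic and special fibre, `2 ∣ a₁(M)` and `a₂(M) := tr(M ⊗ 𝔽₂) = 0`;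
## `Ω = ℚ̄₂`, `L(m)` = points with coordinates in `layer 2 m = ℚ₂(ζ_{2^m})`, `E₁ = kernel`, `Λ = ptLogΩ`)

* §1 `baseChange_algebraicClosure_eq_genFibΩ` (bookkeeping), `not_three_dvd_totient_two_pow`;
  **`eq_zero_of_two_pow_smul_eq_zero_of_mem_subfieldPoints_layer`**: Kobayashi's Prop. 8.7 AT `p = 2` — a point of
  `L(m)` killed by a power of `2` is `O`, for EVERY `m` (file 4: `3 ∣ deg x(P)` on `E[2] ∖ O`, while
  `[ℚ₂(ζ_{2^m}) : ℚ₂] = φ(2^m)` is a power of `2`).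
* §2 **`exists_sub_closure_sub_smul_mem_two`**: the GENERATION STEP at `p = 2` with the torsion hypothesis of file 3
  discharged — for `m ≥ 1`, a tower point `c_m ∈ L(m) ∩ E₁` with `Λ(c_m) = ℓ_m` (file 2: such families exist) and
  `P ∈ L(m) ∩ E₁` there are `B ∈ ℤ[Γ·c_m]`, `R ∈ L(m) ∩ E₁` with `P − B − 2•R ∈ L(m−1)`.
* §3 **`sum_act_add_mem_two`**, **`sum_act_one_mem_two`**: the TRACE RELATIONS at `p = 2` unconditionally —
  `Tr_{m+1/m} c_{m+1} + c_{m−1} ∈ E(ℚ₂)` (`m ≥ 1`) and `Tr_{1/0} c_1 ∈ E(ℚ₂)` (`ζ_2 − 1 = −2`).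
These are the μ_{2^∞}-tower inputs (points, generation, trace relations, torsion-freeness) of the `2`-adic `±`
Coleman theory behind stub (C2) of the line (Kurihara–Otsuki 2006 p. 557: asserted «by the same method as for
`p > 2`»; here PROVED for §8.4/8.7/8.9/8.11 of that method). Not here: the `ℤ₂`-tower `ℚ_{2,n} = ℚ₂(ζ_{2^{n+2}})⁺`
(Δ-trace points `e_n = Tr_{ℚ₂(ζ_{2^{n+2}})/ℚ_{2,n}} c_{n+2}`), the `±` decomposition `E = E⁺ + E⁻` (Prop. 8.12), the
Coleman maps (§8.5–8.6) — see the crux workfile `G2-PORT-AT-2.md`.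

References: [Kobayashi2003] §8.4 (Prop. 8.7, Lemma 8.9, Prop. 8.11, Prop. 8.12); [KuriharaOtsuki2006] p. 557,
Prop. 1.1; [KitajimaOtsuki2018] §3.
-/

set_option autoImplicit false
-- the Theorems namespace of this sub repeats the summit name by design (D-0017 nested layout)
set_option linter.dupNamespace false

noncomputable section

open scoped Classical Topology NNReal
open Filter PowerSeries Finset

namespace Summit.BirchSwinnertonDyer.BirchSwinnertonDyer.Theorems

namespace SignedKatoOffTwo.LocalTwo

open Literature.RingTheory.FormalGroups WeierstrassCurve Field
open Summit.BirchSwinnertonDyer.Rank1Residual.Additive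
open Summit.BirchSwinnertonDyer.Rank1Residual.Additive.PadicCyclotomicTower
open Summit.BirchSwinnertonDyer.Rank1Residual.Additive.BallEval
open Summit.BirchSwinnertonDyer.BirchSwinnertonDyer.Theorems.SignedKatoOffTwo.LocalAllPrimes
open Literature.NumberTheory.EllipticCurves Literature.NumberTheory.EllipticCurves.FormalGroupChart

/-! ## §1 Kobayashi's Prop. 8.7 at `p = 2`: no `2`-power torsion in `E(ℚ₂(ζ_{2^m}))` -/

section Torsion

variable (M : WeierstrassCurve ℤ_[2])

/-- Bookkeeping: `M ⊗ ℚ̄₂` (base change along `ℤ₂ → ℚ̄₂`) is the curve `genFibΩ 2 M = (M ⊗ ℚ₂) ⊗ ℚ̄₂` of the tower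
files. [folklore] -/
theorem baseChange_algebraicClosure_eq_genFibΩ : M.baseChange (AlgebraicClosure ℚ_[2]) = genFibΩ 2 M := by
  rw [genFibΩ, WeierstrassCurve.baseChange, WeierstrassCurve.baseChange, WeierstrassCurve.map_map]
  congr 1

/-- `3 ∤ φ(2^m)` (`φ(2^m) ∈ {1, 2^{m−1}}`). [folklore] -/
theorem not_three_dvd_totient_two_pow (m : ℕ) : ¬ 3 ∣ (2 ^ m).totient := by
  intro h
  rcases Nat.eq_zero_or_pos m with rfl | hm
  · simp at h
  · rw [Nat.totient_prime_pow Nat.prime_two hm] at h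
    norm_num at h
    have := Nat.Prime.dvd_of_dvd_pow Nat.prime_three h
    omega

variable [hEt : (M.map PadicInt.toZMod).IsElliptic]

/-- **Kobayashi's Prop. 8.7 AT `p = 2`**: for a `ℤ₂`-model with elliptic reduction and `2 ∣ a₁` (good supersingular
at `2`), a point of `E(ℚ̄₂)` with coordinates in `ℚ₂(ζ_{2^m})` killed by a power of `2` is `O` — EVERY layer `m` of the
`2`-adic cyclotomic tower (file 4: `3 ∣ deg_{ℚ₂} x(P)` for `P ∈ E[2] ∖ O`, and `[Γ : Stab ζ_{2^m}] = φ(2^m)` is prime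
to `3`). The `htors` hypothesis of the all-primes generation / trace theorems, discharged at `p = 2`.
[cite: Kobayashi2003, Prop. 8.7 (p. 16)] -/
theorem eq_zero_of_two_pow_smul_eq_zero_of_mem_subfieldPoints_layer (h₁ : M.a₁ ∈ IsLocalRing.maximalIdeal ℤ_[2])
    (m : ℕ) {Q : (genFibΩ 2 M).toAffine.Point}
    (hQ : Q ∈ subfieldPoints (genFibΩ 2 M) (layer 2 m).toSubfield coeffs_mem_layer) {k : ℕ} (hk : 2 ^ k • Q = 0) :
    Q = 0 := by
  induction k generalizing Q with
  | zero => rwa [pow_zero, one_smul] at hk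
  | succ k ih =>
    -- `2 • (2^k • Q) = 0` and `2^k • Q ∈ L(m)`: reduce to the `2`-torsion
    -- `2^k • Q ∈ L(m) ⊆ L(m+1)` (a layer of degree `φ(2^{m+1})` over `ℚ₂`) and `2 • (2^k • Q) = 0`
    have hQk : 2 ^ k • Q ∈ subfieldPoints (genFibΩ 2 M) (layer 2 (m + 1)).toSubfield coeffs_mem_layer :=
      subfieldPoints_layer_mono (Nat.le_succ m) ((subfieldPoints _ _ _).nsmul_mem hQ _)
    have h2 : 2 • (2 ^ k • Q) = 0 := by rw [← mul_nsmul, ← pow_succ, hk]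
    suffices h0 : 2 ^ k • Q = 0 from ih hQ h0
    rcases hQk' : (2 ^ k • Q) with _ | ⟨x, y, hxy⟩
    · rfl
    · exfalso
      rw [hQk'] at hQk h2
      obtain ⟨hx, -⟩ := (some_mem_subfieldPoints_iff _ hxy).mp hQk
      refine two_smul_some_ne_zero_of_forall_apply_eq M h₁ (baseChange_algebraicClosure_eq_genFibΩ M)
        (layer 2 (m + 1)).fixingSubgroup ?_ ?_ (fun σ hσ ↦ ?_) h2
      · rw [← IntermediateField.finrank_eq_fixingSubgroup_index, finrank_layer 2 (Nat.succ_pos m)]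
        exact (Nat.totient_pos.mpr (pow_pos two_pos (m + 1))).ne'
      · rw [← IntermediateField.finrank_eq_fixingSubgroup_index, finrank_layer 2 (Nat.succ_pos m)]
        exact not_three_dvd_totient_two_pow (m + 1)
      · exact (IntermediateField.mem_fixingSubgroup_iff _ _).mp hσ _ hx

end Torsion

/-! ## §2 The generation step at `p = 2`, unconditionally -/

section Generation

variable (M : WeierstrassCurve ℤ_[2])
  [hE : (M.map PadicInt.Coe.ringHom).IsElliptic] [hEt : (M.map PadicInt.toZMod).IsElliptic]
  [hintΩ : (genFibΩ 2 M).IsIntegral (Valued.v (R := PadicAlgCl 2)).integer]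

/-- **Kobayashi's generation step AT `p = 2`** (Prop. 8.11 ⇒ Prop. 8.12 ii), μ_{2^∞}-tower): for `m ≥ 1`, a good
supersingular model at `2` (`2 ∣ a₁`, `a₂(M) = 0`), a tower point `c_m ∈ L(m) ∩ E₁` with `Λ(c_m) = ℓ_m` and
`P ∈ E₁(ℚ₂(ζ_{2^m}))`, there are `B ∈ ℤ[Γ·c_m]` and `R ∈ E₁(ℚ₂(ζ_{2^m}))` with `P − B − 2•R ∈ E(ℚ₂(ζ_{2^{m−1}}))` —
file 3 with the torsion hypothesis discharged by §1. [cite: Kobayashi2003, Prop. 8.11, Prop. 8.12]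
[cite: KuriharaOtsuki2006, p. 557] -/
theorem exists_sub_closure_sub_smul_mem_two (h₁ : M.a₁ ∈ IsLocalRing.maximalIdeal ℤ_[2])
    (htr : Literature.NumberTheory.EllipticCurves.HasseManin.tr (M.map PadicInt.toZMod) = 0)
    (act : Field.absoluteGaloisGroup ℚ_[2] → (genFibΩ 2 M).toAffine.Point → (genFibΩ 2 M).toAffine.Point)
    (hact0 : ∀ σ, act σ 0 = 0)
    (hact : ∀ σ (x y : PadicAlgCl 2) (h : (genFibΩ 2 M).toAffine.Nonsingular x y),
      ∃ h', act σ (Affine.Point.some x y h) = Affine.Point.some (σ • x) (σ • y) h')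
    {m : ℕ} (hm : 1 ≤ m) {cm : (genFibΩ 2 M).toAffine.Point}
    (hcL : cm ∈ subfieldPoints (genFibΩ 2 M) (layer 2 m).toSubfield coeffs_mem_layer)
    (hck : cm ∈ kernel (Valued.v (R := PadicAlgCl 2)) (genFibΩ 2 M)) (hcℓ : ptLogΩ 2 M cm = ell 2 m)
    {P : (genFibΩ 2 M).toAffine.Point} (hP : P ∈ subfieldPoints (genFibΩ 2 M) (layer 2 m).toSubfield coeffs_mem_layer)
    (hPk : P ∈ kernel (Valued.v (R := PadicAlgCl 2)) (genFibΩ 2 M)) :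
    ∃ B ∈ AddSubgroup.closure (Set.range fun σ : Field.absoluteGaloisGroup ℚ_[2] => act σ cm),
      ∃ R ∈ subfieldPoints (genFibΩ 2 M) (layer 2 m).toSubfield coeffs_mem_layer,
        R ∈ kernel (Valued.v (R := PadicAlgCl 2)) (genFibΩ 2 M) ∧
        P - B - 2 • R ∈ subfieldPoints (genFibΩ 2 M) (layer 2 (m - 1)).toSubfield coeffs_mem_layer :=
  exists_sub_closure_sub_smul_mem' htr act hact0 hact hm hcL hck hcℓ
    (fun _ hQ _ hk ↦ eq_zero_of_two_pow_smul_eq_zero_of_mem_subfieldPoints_layer M h₁ m hQ hk) hP hPk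

end Generation

/-! ## §3 The trace relations at `p = 2`, unconditionally -/

section Trace

variable (M : WeierstrassCurve ℤ_[2])
  [hE : (M.map PadicInt.Coe.ringHom).IsElliptic] [hEt : (M.map PadicInt.toZMod).IsElliptic]
  [hintΩ : (genFibΩ 2 M).IsIntegral (Valued.v (R := PadicAlgCl 2)).integer]

/-- **The trace relation of Lemma 8.9 AT `p = 2`, `m ≥ 1`**: for tower points `c_{m+1} ∈ E₁(ℚ₂(ζ_{2^{m+1}}))`,
`c_{m−1} ∈ E₁(ℚ₂(ζ_{2^{m−1}}))` with `Λ = ℓ` on a good supersingular model at `2` (`2 ∣ a₁`),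
`(∑_{q ∈ Stab ζ_{2^m} / Stab ζ_{2^{m+1}}} act q̃ c_{m+1}) + c_{m−1} ∈ E(ℚ₂)` — no torsion hypothesis (§1).
[cite: Kobayashi2003, Lemma 8.9] -/
theorem sum_act_add_mem_two (h₁ : M.a₁ ∈ IsLocalRing.maximalIdeal ℤ_[2])
    (act : Field.absoluteGaloisGroup ℚ_[2] → (genFibΩ 2 M).toAffine.Point → (genFibΩ 2 M).toAffine.Point)
    (hact0 : ∀ σ, act σ 0 = 0)
    (hact : ∀ σ (x y : PadicAlgCl 2) (h : (genFibΩ 2 M).toAffine.Nonsingular x y),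
      ∃ h', act σ (Affine.Point.some x y h) = Affine.Point.some (σ • x) (σ • y) h')
    {m : ℕ} (hm : 1 ≤ m)
    [Fintype (stab 2 m ⧸ (stab 2 (m + 1)).subgroupOf (stab 2 m))]
    {c c' : (genFibΩ 2 M).toAffine.Point}
    (hcL : c ∈ subfieldPoints (genFibΩ 2 M) (layer 2 (m + 1)).toSubfield coeffs_mem_layer)
    (hck : c ∈ kernel (Valued.v (R := PadicAlgCl 2)) (genFibΩ 2 M)) (hcℓ : ptLogΩ 2 M c = ell 2 (m + 1))
    (hc'L : c' ∈ subfieldPoints (genFibΩ 2 M) (layer 2 (m - 1)).toSubfield coeffs_mem_layer)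
    (hc'k : c' ∈ kernel (Valued.v (R := PadicAlgCl 2)) (genFibΩ 2 M)) (hc'ℓ : ptLogΩ 2 M c' = ell 2 (m - 1)) :
    (∑ q : stab 2 m ⧸ (stab 2 (m + 1)).subgroupOf (stab 2 m), act ((q.out : stab 2 m) : Field.absoluteGaloisGroup ℚ_[2]) c) +
        c' ∈ subfieldPoints (genFibΩ 2 M) (layer 2 0).toSubfield coeffs_mem_layer :=
  sum_act_add_mem' act hact0 hact hm
    (fun _ hQ _ hk ↦ eq_zero_of_two_pow_smul_eq_zero_of_mem_subfieldPoints_layer M h₁ (m + 1) hQ hk)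
    hcL hck hcℓ hc'L hc'k hc'ℓ

/-- **The bottom trace relation AT `p = 2`**: `∑_{q ∈ Γ / Stab ζ_2} act q̃ c_1 ∈ E(ℚ₂)` for a tower point `c_1`
with `Λ(c_1) = ℓ_1 = ζ_2 − 1 = −2` (here `Stab ζ_2 = Γ`: the sum is `c_1` itself, a point of logarithm `−2`) — no
torsion hypothesis (§1). [cite: Kobayashi2003, Lemma 8.9] -/
theorem sum_act_one_mem_two (h₁ : M.a₁ ∈ IsLocalRing.maximalIdeal ℤ_[2])
    (act : Field.absoluteGaloisGroup ℚ_[2] → (genFibΩ 2 M).toAffine.Point → (genFibΩ 2 M).toAffine.Point)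
    (hact0 : ∀ σ, act σ 0 = 0)
    (hact : ∀ σ (x y : PadicAlgCl 2) (h : (genFibΩ 2 M).toAffine.Nonsingular x y),
      ∃ h', act σ (Affine.Point.some x y h) = Affine.Point.some (σ • x) (σ • y) h')
    [Fintype (stab 2 0 ⧸ (stab 2 1).subgroupOf (stab 2 0))]
    {c : (genFibΩ 2 M).toAffine.Point}
    (hcL : c ∈ subfieldPoints (genFibΩ 2 M) (layer 2 1).toSubfield coeffs_mem_layer)
    (hck : c ∈ kernel (Valued.v (R := PadicAlgCl 2)) (genFibΩ 2 M)) (hcℓ : ptLogΩ 2 M c = ell 2 1) :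
    (∑ q : stab 2 0 ⧸ (stab 2 1).subgroupOf (stab 2 0), act ((q.out : stab 2 0) : Field.absoluteGaloisGroup ℚ_[2]) c) ∈
      subfieldPoints (genFibΩ 2 M) (layer 2 0).toSubfield coeffs_mem_layer :=
  sum_act_one_mem' act hact0 hact
    (fun _ hQ _ hk ↦ eq_zero_of_two_pow_smul_eq_zero_of_mem_subfieldPoints_layer M h₁ 1 hQ hk) hcL hck hcℓ

end Trace

end SignedKatoOffTwo.LocalTwo

end Summit.BirchSwinnertonDyer.BirchSwinnertonDyer.Theorems

end
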